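import Literature.NumberTheory.EllipticCurves.PAdicLFunctionTameCongruenceAtTwoAutoProofs
import Literature.NumberTheory.EllipticCurves.PAdicLFunctionTameIntegralityAtTwoSharedPrimesProofs
import Literature.NumberTheory.EllipticCurves.PAdicLFunctionTameLevelChangeAtLevelPrimeProofs
import Literature.NumberTheory.EllipticCurves.PlusSymbolBoundOddMultiplicativeProofs
import Literature.NumberTheory.EllipticCurves.RootNumberTwistProofs
import Literature.NumberTheory.EllipticCurves.HasseWeilAbelianBadReduction
import HarnessLib

/-!
# The tame `2`-adic congruence `L₂(f,α,χ) ≡ u·L₂(f,α)·∏_{v∈S₀}𝒫_v (mod 2Λ)` at a tame level whose places are GOOD OR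
# MULTIPLICATIVE (Matsuno 2000, Lemmas 3.2–3.3 at `p = 2`, with `ε(ℓ) = 0` at `ℓ ∥ N`; PROOFS ONLY)

Cell bsd-2adic, seat conv-1 (GEN 16; road «S3 twist road without the coprimality `(d, N_E) = 1` at the multiplicative
primes of `E`»). The tree's `exists_iwasawa_padicLFunctionTame_congr_two_auto`
(`PAdicLFunctionTameCongruenceAtTwoAutoProofs`) is the congruence for a finite set `S₀` of odd places of GOOD reduction,
`m = ∏_{v∈S₀} ℓ_v`. This file allows MULTIPLICATIVE places in `S₀` (`ℓ_v ∥ N`, `a_{ℓ_v} = ±1`):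

* §1 `natCast_mul_eulerFactorElement_of_hasSplitMultiplicativeReductionAt` / `…_of_nonsplit`,
  `map_toZMod_eulerFactorElement_two_eq_of_hasMultiplicativeReductionAt` — Greenberg–Vatsal's Euler element at a
  multiplicative place, `𝒫_v = P_v(ℓ⁻¹(1+T)^{f_ℓ})` with `P_v = 1 ∓ X` (`localPolynomialAt_of_hasSplitMultiplicativeReductionAt`,
  `…_of_not_hasSplitMultiplicativeReductionAt`): `ℓ·𝒫_v = ℓ ∓ (1+T)^{f_ℓ}`, hence at `p = 2`, `ℓ` odd, for `a = ±1`: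
  `𝒫_v ≡ a − (1+T)^{f_ℓ} (mod 2)` — Matsuno's depletion factor at `ℓ ∣ N` (`padicLFunctionTame_mul_prime_of_dvd`) IS `𝒫_v` mod `2`;
* §2 **`exists_iwasawa_padicLFunctionTame_one_congr_two_sqfreeAt`** — for `E = W/ℚ` good ordinary at `2`, `f` its newform
  (level `N`), `S₀` a finite set of odd places each of good OR multiplicative reduction, `m = ∏ ℓ_v`: there are
  `L_W, G₁ ∈ Λ`, `u ∈ Λˣ` with `ι L_W = L₂(f,α)`, `ι G₁ = L₂(f,α,𝟙_m)` and `G₁ ≡ u·L_W·∏_{v∈S₀}𝒫_v (mod 2)`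
  (`iwasawaToPowerSeries_prod_tameEulerFactor_mul_sqfreeAt` + §1 + the tree's good-place `map_toZMod_eulerFactorElement_two_eq`;
  NO `E[2]` hypothesis, `L₂ ∈ Λ` by INT2-AUTO);
* §3 **`exists_iwasawa_padicLFunctionTame_congr_two_sqfreeAt`** — with the character half at such a level
  (`exists_iwasawa_pair_map_toZMod_eq_two_sqfreeAt`: `N` is square-free at the primes of `m` because `ℓ_v ∥ N` at the
  multiplicative places, `IsNewformOf.dvd_level_and_not_sq_dvd_of_multiplicative`): for `χ` even quadratic mod `m`,
  `L₂(f,α,χ) ≡ u·L₂(f,α)·∏_{v∈S₀}𝒫_v (mod 2)`.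

So the congruence `hcong` of the cell's analytic Kida door holds at tame levels meeting `N` at multiplicative primes; what
remains for the twist road is Birch's lemma for `(d, N_E) ⊋ 1` (next file). Everything is proved; nothing is asserted.

References: K. Matsuno, J. Number Theory 84 (2000), Lemmas 3.2–3.3 and proof of Thm. 3.1 (pp. 86–88) [Matsuno2000];
R. Greenberg, V. Vatsal, Invent. Math. 142 (2000), §1 p. 9 (display (8)), §2 Prop. (2.4) [GreenbergVatsal2000];
J. H. Silverman, *AEC* (2009), App. C §16 (local factors `1 ∓ T` at multiplicative primes) [SilvermanAEC2009].
-/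

noncomputable section

open scoped Classical MatrixGroups ModularForm

open NumberField IsDedekindDomain WeierstrassCurve CongruenceSubgroup PowerSeries
  Literature.NumberTheory.EllipticCurves.ModularForms Literature.NumberTheory.EllipticCurves.GreenbergVatsal2000

namespace Literature.NumberTheory.EllipticCurves

/-! ### §1. Greenberg–Vatsal's `𝒫_v` at a multiplicative place, and its class mod `2` -/

section EulerFactorMult

variable (W : WeierstrassCurve ℚ) (p : ℕ) [Fact p.Prime] (v : HeightOneSpectrum (𝓞 ℚ))

/-- A natural number prime to `p` is a unit of `ℤ_p`; private helper. [folklore] -/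
private theorem isUnit_natCast_padicInt_of_coprime' {ℓ : ℕ} (hℓp : ℓ.Coprime p) : IsUnit (ℓ : ℤ_[p]) := by
  rw [PadicInt.isUnit_iff]
  refine le_antisymm (PadicInt.norm_le_one _) (not_lt.mp fun h ↦ ?_)
  have h' : ‖((ℓ : ℤ) : ℤ_[p])‖ < 1 := by rwa [Int.cast_natCast]
  rw [PadicInt.norm_int_lt_one_iff_dvd, Int.natCast_dvd_natCast] at h'
  exact (Nat.Prime.coprime_iff_not_dvd Fact.out).mp hℓp.symm h'

/-- **`ℓ·𝒫_v = ℓ − (1+T)^{f_ℓ}` at a place of SPLIT multiplicative reduction** (`ℓ = ℓ_v ≠ p`): Greenberg–Vatsal's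
`𝒫_v = P_v(ℓ⁻¹(1+T)^{f_ℓ})` with `P_v = 1 − X` (`localPolynomialAt_of_hasSplitMultiplicativeReductionAt`).
[cite: GreenbergVatsal2000, §1 pp. 8–9 and §2 Prop. (2.4) (𝒫_ℓ = P_ℓ(ℓ⁻¹γ_ℓ))] [cite: SilvermanAEC2009, §C.16 (PDF p. 390)] -/
theorem natCast_mul_eulerFactorElement_of_hasSplitMultiplicativeReductionAt
    (hv : W.HasSplitMultiplicativeReductionAt v) (hℓp : (Rat.HeightOneSpectrum.natGenerator v).Coprime p) :
    PowerSeries.C (Rat.HeightOneSpectrum.natGenerator v : ℤ_[p]) * eulerFactorElement W p v =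
      PowerSeries.C (Rat.HeightOneSpectrum.natGenerator v : ℤ_[p]) -
        frobeniusSeries p (Rat.HeightOneSpectrum.natGenerator v) := by
  have hinv : PowerSeries.C (Rat.HeightOneSpectrum.natGenerator v : ℤ_[p]) *
      PowerSeries.C ((Rat.HeightOneSpectrum.natGenerator v : ℤ_[p]).inv) = 1 := by
    rw [← map_mul, PadicInt.mul_inv (PadicInt.isUnit_iff.mp (isUnit_natCast_padicInt_of_coprime' p hℓp)), map_one]
  have hP : eulerFactorElement W p v =
      1 - PowerSeries.C ((Rat.HeightOneSpectrum.natGenerator v : ℤ_[p]).inv) *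
        frobeniusSeries p (Rat.HeightOneSpectrum.natGenerator v) := by
    rw [eulerFactorElement, eulerFactorPoint, localPolynomialAt_of_hasSplitMultiplicativeReductionAt hv]
    simp only [map_sub, map_one, Polynomial.aeval_X]
  rw [hP, mul_sub, mul_one, ← mul_assoc, hinv, one_mul]

/-- **`ℓ·𝒫_v = ℓ + (1+T)^{f_ℓ}` at a place of NON-SPLIT multiplicative reduction** (`ℓ = ℓ_v ≠ p`): `P_v = 1 + X`
(`localPolynomialAt_of_hasMultiplicativeReductionAt_of_not_hasSplitMultiplicativeReductionAt`).
[cite: GreenbergVatsal2000, §1 pp. 8–9 and §2 Prop. (2.4) (𝒫_ℓ = P_ℓ(ℓ⁻¹γ_ℓ))] [cite: SilvermanAEC2009, §C.16 (PDF p. 390)] -/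
theorem natCast_mul_eulerFactorElement_of_nonsplit (hv : W.HasMultiplicativeReductionAt v)
    (hns : ¬ W.HasSplitMultiplicativeReductionAt v) (hℓp : (Rat.HeightOneSpectrum.natGenerator v).Coprime p) :
    PowerSeries.C (Rat.HeightOneSpectrum.natGenerator v : ℤ_[p]) * eulerFactorElement W p v =
      PowerSeries.C (Rat.HeightOneSpectrum.natGenerator v : ℤ_[p]) +
        frobeniusSeries p (Rat.HeightOneSpectrum.natGenerator v) := by
  have hinv : PowerSeries.C (Rat.HeightOneSpectrum.natGenerator v : ℤ_[p]) *
      PowerSeries.C ((Rat.HeightOneSpectrum.natGenerator v : ℤ_[p]).inv) = 1 := by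
    rw [← map_mul, PadicInt.mul_inv (PadicInt.isUnit_iff.mp (isUnit_natCast_padicInt_of_coprime' p hℓp)), map_one]
  have hP : eulerFactorElement W p v =
      1 + PowerSeries.C ((Rat.HeightOneSpectrum.natGenerator v : ℤ_[p]).inv) *
        frobeniusSeries p (Rat.HeightOneSpectrum.natGenerator v) := by
    rw [eulerFactorElement, eulerFactorPoint,
      localPolynomialAt_of_hasMultiplicativeReductionAt_of_not_hasSplitMultiplicativeReductionAt hv hns]
    simp only [map_add, map_one, Polynomial.aeval_X]
  rw [hP, mul_add, mul_one, ← mul_assoc, hinv, one_mul]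

/-- **At `p = 2`, `ℓ` odd, `v` multiplicative: `𝒫_v ≡ a − (1+T)^{f_ℓ} (mod 2)` for `a = ±1`** — so at a multiplicative place
Greenberg–Vatsal's Euler element and Matsuno's depletion factor `a_ℓ − (1+T)^{f_ℓ}` (`padicLFunctionTame_mul_prime_of_dvd`,
`a_ℓ = ±1`) have the same image in `𝔽₂⟦T⟧` (`ℓ ≡ 1`, `−1 ≡ 1 (mod 2)`). The multiplicative companion of
`map_toZMod_eulerFactorElement_two_eq`. [cite: GreenbergVatsal2000, §2 Prop. (2.4) (p. 22)] [cite: Matsuno2000, Lemma 3.3 (pp. 87–88)] -/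
theorem map_toZMod_eulerFactorElement_two_eq_of_hasMultiplicativeReductionAt (hv : W.HasMultiplicativeReductionAt v)
    (hℓ2 : (Rat.HeightOneSpectrum.natGenerator v).Coprime 2) {a : ℤ} (ha : a = 1 ∨ a = -1) :
    PowerSeries.map (PadicInt.toZMod (p := 2)) (eulerFactorElement W 2 v) =
      PowerSeries.map (PadicInt.toZMod (p := 2))
        (PowerSeries.C (a : ℤ_[2]) - frobeniusSeries 2 (Rat.HeightOneSpectrum.natGenerator v)) := by
  have hℓ1 : PadicInt.toZMod (p := 2) (Rat.HeightOneSpectrum.natGenerator v : ℤ_[2]) = 1 := by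
    rw [map_natCast, ZMod.natCast_eq_one_iff_odd]
    exact Nat.coprime_two_left.mp hℓ2.symm
  have h2 : PowerSeries.map (PadicInt.toZMod (p := 2)) (PowerSeries.C (2 : ℤ_[2])) = 0 := by
    rw [PowerSeries.map_C]
    have : PadicInt.toZMod (p := 2) (2 : ℤ_[2]) = 0 := by
      have h := map_natCast (PadicInt.toZMod (p := 2)) 2
      rw [Nat.cast_ofNat] at h
      rw [h]
      exact ZMod.natCast_self 2
    rw [this, map_zero]
  -- the right-hand side does not depend on the sign of `a` modulo `2`
  have hRHS : PowerSeries.map (PadicInt.toZMod (p := 2))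
      (PowerSeries.C (a : ℤ_[2]) - frobeniusSeries 2 (Rat.HeightOneSpectrum.natGenerator v)) =
      PowerSeries.map (PadicInt.toZMod (p := 2))
        (1 - frobeniusSeries 2 (Rat.HeightOneSpectrum.natGenerator v)) := by
    rcases ha with rfl | rfl
    · rw [Int.cast_one, map_one]
    · have he : PowerSeries.C ((-1 : ℤ) : ℤ_[2]) - frobeniusSeries 2 (Rat.HeightOneSpectrum.natGenerator v) =
          (1 - frobeniusSeries 2 (Rat.HeightOneSpectrum.natGenerator v)) - PowerSeries.C (2 : ℤ_[2]) := by
        rw [Int.cast_neg, Int.cast_one, map_neg, map_one, show (2 : ℤ_[2]) = 1 + 1 by norm_num, map_add, map_one]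
        ring
      rw [he, map_sub, h2, sub_zero]
  rw [hRHS]
  by_cases hs : W.HasSplitMultiplicativeReductionAt v
  · have h := congrArg (PowerSeries.map (PadicInt.toZMod (p := 2)))
      (natCast_mul_eulerFactorElement_of_hasSplitMultiplicativeReductionAt W 2 v hs hℓ2)
    rw [map_mul, PowerSeries.map_C, hℓ1, map_one, one_mul, map_sub, PowerSeries.map_C, hℓ1] at h
    rw [h]
    simp only [map_sub, map_one]
  · have h := congrArg (PowerSeries.map (PadicInt.toZMod (p := 2)))
      (natCast_mul_eulerFactorElement_of_nonsplit W 2 v hv hs hℓ2)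
    rw [map_mul, PowerSeries.map_C, hℓ1, map_one, one_mul, map_add, PowerSeries.map_C, hℓ1] at h
    rw [h]
    simp only [map_sub, map_one]
    -- `1 + B̄ = 1 − B̄` in characteristic `2`: `2B̄ = 0`
    have h2B : PowerSeries.map (PadicInt.toZMod (p := 2)) (frobeniusSeries 2 (Rat.HeightOneSpectrum.natGenerator v)) +
        PowerSeries.map (PadicInt.toZMod (p := 2)) (frobeniusSeries 2 (Rat.HeightOneSpectrum.natGenerator v)) = 0 := by
      rw [← map_add, ← two_mul, show (2 : IwasawaAlgebra 2) = PowerSeries.C (2 : ℤ_[2]) by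
        rw [show (2 : ℤ_[2]) = 1 + 1 by norm_num, map_add, map_one]; norm_num, map_mul, h2, zero_mul]
    linear_combination h2B

end EulerFactorMult

/-! ### §2. The depletion half at a tame level whose places are good or multiplicative -/

section DepletionAtTwo

variable {N : ℕ} [NeZero N] {f : CuspForm (Gamma0 N) 2}
  {W : WeierstrassCurve ℚ} [W.IsElliptic] [W.IsGloballyMinimal]

/-- Distinct finite places of `ℚ` lie over distinct primes; private helper. [folklore] -/
private theorem natGenerator_injective_rat''' :
    Function.Injective (Rat.HeightOneSpectrum.natGenerator (R := 𝓞 ℚ)) := fun _ _ h ↦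
  (Rat.HeightOneSpectrum.primesEquiv (R := 𝓞 ℚ)).injective (Subtype.ext h)

/-- `−(1+T)^{c}` is a unit of `Λ`; private helper. [folklore] -/
private theorem isUnit_neg_binomialSeries'' {p : ℕ} [Fact p.Prime] (c : ℤ_[p]) :
    IsUnit (-PowerSeries.binomialSeries ℤ_[p] c) := by
  refine (isUnit_iff_exists_inv.mpr ⟨PowerSeries.binomialSeries ℤ_[p] (-c), ?_⟩).neg
  rw [← PowerSeries.binomialSeries_add, add_neg_cancel, PowerSeries.binomialSeries_zero]

omit [W.IsElliptic] in
/-- **Level data at a place of good OR multiplicative reduction** for the newform `f` (level `N`) of `E = W`: with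
`ℓ = ℓ_v`, either `v` is good and `ℓ ∤ N`, or `v` is multiplicative and `ℓ ∣ N`, `ℓ² ∤ N`; in both cases `ℓ² ∤ N`
(`not_dvd_level_of_isNewformOf`, `IsNewformOf.dvd_level_and_not_sq_dvd_of_multiplicative`); private helper.
[cite: AtkinLehner1970, Thm. 3] -/
private theorem not_sq_dvd_level_of_good_or_mult (hf : IsNewformOf W f) {v : HeightOneSpectrum (𝓞 ℚ)}
    (hv : W.HasGoodReductionAt v ∨ W.HasMultiplicativeReductionAt v) :
    ¬ Rat.HeightOneSpectrum.natGenerator v ^ 2 ∣ N ∧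
      (W.HasGoodReductionAt v → ¬ Rat.HeightOneSpectrum.natGenerator v ∣ N) ∧
      (W.HasMultiplicativeReductionAt v → Rat.HeightOneSpectrum.natGenerator v ∣ N) := by
  haveI := hf.isElliptic
  haveI : Fact (Rat.HeightOneSpectrum.natGenerator v).Prime := ⟨(Rat.HeightOneSpectrum.primesEquiv v).2⟩
  have hgoodN : W.HasGoodReductionAt v → ¬ Rat.HeightOneSpectrum.natGenerator v ∣ N := fun hg ↦
    not_dvd_level_of_isNewformOf hf ((hasGoodReductionAtPrime_iff_hasGoodReductionAt_ringOfIntegers v W).mpr hg)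
  have hmultN : W.HasMultiplicativeReductionAt v →
      Rat.HeightOneSpectrum.natGenerator v ∣ N ∧ ¬ Rat.HeightOneSpectrum.natGenerator v ^ 2 ∣ N := fun hm ↦ by
    have hmp : W.HasMultiplicativeReductionAtPrime (Rat.HeightOneSpectrum.natGenerator v) :=
      (W.hasMultiplicativeReductionAtPrime_iff_hasMultiplicativeReductionAt_ringOfIntegers v).mpr hm
    obtain ⟨h1, h2, -⟩ := hf.dvd_level_and_not_sq_dvd_of_multiplicative hmp
    exact ⟨h1, h2⟩
  refine ⟨?_, hgoodN, fun hm ↦ (hmultN hm).1⟩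
  rcases hv with hg | hm
  · exact fun h ↦ hgoodN hg ((dvd_pow_self _ two_ne_zero).trans h)
  · exact (hmultN hm).2

/-- **The `m`-depleted `2`-adic `L`-function vs `L₂(E)·∏𝒫_v` modulo `2`, at a tame level whose places are good or
multiplicative.** For `E = W/ℚ` globally minimal, good ordinary at `2`, `f` its newform (level `N`), `S₀` a finite set of ODD
places each of GOOD or MULTIPLICATIVE reduction and `m = ∏_{v∈S₀} ℓ_v`: there are `L_W, G₁ ∈ ℤ₂⟦T⟧` and `u ∈ ℤ₂⟦T⟧ˣ` with
`ι L_W = L₂(f,α)` (INT2-AUTO), `ι G₁ = L₂(f,α,𝟙_m)` and `G₁ ≡ u · L_W · ∏_{v∈S₀} 𝒫_v (mod 2)` — Matsuno's Lemma 3.3 iterated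
with `ε(ℓ) = 0` at the multiplicative places (`iwasawaToPowerSeries_prod_tameEulerFactor_mul_sqfreeAt`:
`G₁ = ∏ h_ℓ · L_W`, `h_ℓ = a_ℓ − (1+T)^{f_ℓ} − [ℓ ∤ N](1+T)^{−f_ℓ}`), `𝒫_v ≡ −(1+T)^{f_ℓ}h_ℓ` at good `v`
(`map_toZMod_eulerFactorElement_two_eq`) and `𝒫_v ≡ h_ℓ` at multiplicative `v` (§1). The companion of
`exists_iwasawa_padicLFunctionTame_one_congr_two_auto` (good places only). [cite: Matsuno2000, Lemma 3.3 and proof of Theorem 3.1 (pp. 87–88)]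
[cite: GreenbergVatsal2000, §1 p. 9 (display (8)) and §2 Prop. (2.4)] -/
theorem exists_iwasawa_padicLFunctionTame_one_congr_two_sqfreeAt (hord : IsOrdinaryAt W 2) (hf : IsNewformOf W f)
    (S₀ : Finset (HeightOneSpectrum (𝓞 ℚ))) (hS2 : ∀ v ∈ S₀, Rat.HeightOneSpectrum.natGenerator v ≠ 2)
    (hred : ∀ v ∈ S₀, W.HasGoodReductionAt v ∨ W.HasMultiplicativeReductionAt v)
    {m : ℕ} [NeZero m] (hm : m = ∏ v ∈ S₀, Rat.HeightOneSpectrum.natGenerator v) :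
    ∃ (LW G₁ : IwasawaAlgebra 2) (u : (IwasawaAlgebra 2)ˣ),
      iwasawaToPowerSeries 2 LW = padicLFunction f (unitRoot W 2 : ℚ_[2]) ∧
      iwasawaToPowerSeries 2 G₁ = padicLFunctionTame f m (unitRoot W 2 : ℚ_[2]) 1 ∧
      PowerSeries.map (PadicInt.toZMod (p := 2)) G₁ =
        PowerSeries.map (PadicInt.toZMod (p := 2)) ((u : IwasawaAlgebra 2) * LW * eulerFactorProduct W 2 S₀) := by
  obtain ⟨LW, hLW⟩ := exists_iwasawaToPowerSeries_eq_padicLFunction_two_auto hord hf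
  obtain ⟨hαeq, hαu, -⟩ := unitRoot_coe_spec (W := W) hord
  have hpN : ¬ 2 ∣ N := not_dvd_level_of_isNewformOf hf hord.1
  have hprime : ∀ v : HeightOneSpectrum (𝓞 ℚ), (Rat.HeightOneSpectrum.natGenerator v).Prime := fun v ↦
    (Rat.HeightOneSpectrum.primesEquiv v).2
  have hcop : ∀ v ∈ S₀, (Rat.HeightOneSpectrum.natGenerator v).Coprime 2 := fun v hv ↦
    (Nat.coprime_primes (hprime v) Nat.prime_two).mpr (hS2 v hv)
  -- the coefficients `a ℓ`: `a_ℓ(E)` at the good primes, `±1` at the multiplicative ones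
  set a : ℕ → ℤ := fun ℓ ↦ if ℓ ∣ N then
      (if h : ℓ.Prime then (haveI : Fact ℓ.Prime := ⟨h⟩; if W.HasSplitMultiplicativeReductionAtPrime ℓ then 1 else -1)
        else 0)
    else W.frobeniusTrace ℓ with hadef
  -- Teichmüller data `ℓ ≡ ω(ℓ) γ^{f_ℓ}` at every finite level
  set teich : ℕ → rootsOfUnity (torsionOrder 2) ℤ_[2] := fun ℓ ↦
    if h : ℓ.Coprime 2 then Classical.choose (exists_teichmuller_frobeniusExponent 2 h) else 1 with hteich
  have hc : ∀ ℓ ∈ S₀.image Rat.HeightOneSpectrum.natGenerator, ∀ n : ℕ,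
      PadicInt.toZModPow (n + cyclotomicExponent 2) ((teich ℓ : ℤ_[2]ˣ) : ℤ_[2]) *
        (cyclotomicGenerator 2 : ZMod (2 ^ (n + cyclotomicExponent 2))) ^
          (PadicInt.toZModPow n ((fun ℓ : ℕ ↦ frobeniusExponent 2 (ℓ : ℤ_[2])) ℓ)).val =
          (ℓ : ZMod (2 ^ (n + cyclotomicExponent 2))) := by
    intro ℓ hℓ n
    obtain ⟨v, hv, rfl⟩ := Finset.mem_image.mp hℓ
    have h := hcop v hv
    simp only [hteich, dif_pos h]
    exact Classical.choose_spec (exists_teichmuller_frobeniusExponent 2 h) n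
  have hS : ∀ ℓ ∈ S₀.image Rat.HeightOneSpectrum.natGenerator, ℓ.Prime ∧ ℓ.Coprime 2 := by
    intro ℓ hℓ
    obtain ⟨v, hv, rfl⟩ := Finset.mem_image.mp hℓ
    exact ⟨hprime v, hcop v hv⟩
  -- `a_ℓ(f) = a ℓ` at every place of `S₀`
  have ha : ∀ ℓ ∈ S₀.image Rat.HeightOneSpectrum.natGenerator, cuspCoeff f ℓ = ((a ℓ : ℤ) : ℂ) := by
    intro ℓ hℓ
    obtain ⟨v, hv, rfl⟩ := Finset.mem_image.mp hℓ
    haveI : Fact (Rat.HeightOneSpectrum.natGenerator v).Prime := ⟨hprime v⟩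
    obtain ⟨-, hgoodN, hmultN⟩ := not_sq_dvd_level_of_good_or_mult hf (hred v hv)
    rcases hred v hv with hg | hmul
    · have hgp : W.HasGoodReductionAtPrime (Rat.HeightOneSpectrum.natGenerator v) :=
        (hasGoodReductionAtPrime_iff_hasGoodReductionAt_ringOfIntegers v W).mpr hg
      rw [cuspCoeff_eq_frobeniusTrace_of_isNewformOf_holds hf hgp, hadef]
      simp only [if_neg (hgoodN hg)]
    · have hmp : W.HasMultiplicativeReductionAtPrime (Rat.HeightOneSpectrum.natGenerator v) :=
        (W.hasMultiplicativeReductionAtPrime_iff_hasMultiplicativeReductionAt_ringOfIntegers v).mpr hmul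
      by_cases hs : W.HasSplitMultiplicativeReductionAtPrime (Rat.HeightOneSpectrum.natGenerator v)
      · rw [(hf.cuspCoeff_eq_one_and_sq_of_split hs).1, hadef]
        simp only [if_pos (hmultN hmul), dif_pos (hprime v), if_pos hs, Int.cast_one]
      · rw [(hf.cuspCoeff_eq_neg_one_and_dvd_of_nonsplit hmp hs).1, hadef]
        simp only [if_pos (hmultN hmul), dif_pos (hprime v), if_neg hs, Int.cast_neg, Int.cast_one]
  have hinj : ∀ v ∈ S₀, ∀ w ∈ S₀,
      Rat.HeightOneSpectrum.natGenerator v = Rat.HeightOneSpectrum.natGenerator w → v = w :=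
    fun v _ w _ h ↦ natGenerator_injective_rat''' h
  have hm' : m = ∏ ℓ ∈ S₀.image Rat.HeightOneSpectrum.natGenerator, ℓ := by
    rw [hm, Finset.prod_image hinj]
  have hG₁ := iwasawaToPowerSeries_prod_tameEulerFactor_mul_sqfreeAt hf.1 hf.coeffField_eq_bot hpN
    (cuspCoeff_eq_frobeniusTrace_of_isNewformOf_holds hf hord.1) hαeq hαu (a := a)
    (teich := teich) (c := fun ℓ : ℕ ↦ frobeniusExponent 2 (ℓ : ℤ_[2])) hS ha hc hm' hLW
  -- the unit: `−(1+T)^{−f_ℓ}` at the good places, `1` at the multiplicative ones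
  set uv : HeightOneSpectrum (𝓞 ℚ) → (IwasawaAlgebra 2)ˣ := fun v ↦
    if Rat.HeightOneSpectrum.natGenerator v ∣ N then 1 else
      (isUnit_neg_binomialSeries'' (-frobeniusExponent 2 (Rat.HeightOneSpectrum.natGenerator v : ℤ_[2]))).unit with huv
  -- per place: `u_v 𝒫_v ≡ h_ℓ (mod 2)`
  have key : ∀ v ∈ S₀, PowerSeries.map (PadicInt.toZMod (p := 2))
      (C ((a (Rat.HeightOneSpectrum.natGenerator v) : ℤ) : ℤ_[2]) -
        PowerSeries.binomialSeries ℤ_[2] (frobeniusExponent 2 (Rat.HeightOneSpectrum.natGenerator v : ℤ_[2])) -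
        (if Rat.HeightOneSpectrum.natGenerator v ∣ N then 0 else
          PowerSeries.binomialSeries ℤ_[2] (-frobeniusExponent 2 (Rat.HeightOneSpectrum.natGenerator v : ℤ_[2])))) =
      PowerSeries.map (PadicInt.toZMod (p := 2)) ((uv v : IwasawaAlgebra 2) * eulerFactorElement W 2 v) := by
    intro v hv
    haveI : Fact (Rat.HeightOneSpectrum.natGenerator v).Prime := ⟨hprime v⟩
    obtain ⟨-, hgoodN, hmultN⟩ := not_sq_dvd_level_of_good_or_mult hf (hred v hv)
    rcases hred v hv with hg | hmul
    · -- good place: the tree's computation, `u_v = −(1+T)^{−f_ℓ}`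
      have hℓN : ¬ Rat.HeightOneSpectrum.natGenerator v ∣ N := hgoodN hg
      have hE := map_toZMod_eulerFactorElement_two_eq W v hg (hcop v hv)
      rw [frobeniusTraceAt_eq_frobeniusTrace] at hE
      have huv_val : ((uv v : (IwasawaAlgebra 2)ˣ) : IwasawaAlgebra 2) =
          -PowerSeries.binomialSeries ℤ_[2] (-frobeniusExponent 2 (Rat.HeightOneSpectrum.natGenerator v : ℤ_[2])) := by
        rw [huv]
        simp only [if_neg hℓN]
        exact IsUnit.unit_spec _
      have haℓ : a (Rat.HeightOneSpectrum.natGenerator v) = W.frobeniusTrace (Rat.HeightOneSpectrum.natGenerator v) := by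
        rw [hadef]; simp only [if_neg hℓN]
      rw [if_neg hℓN, haℓ, map_mul, hE, ← map_mul, huv_val, frobeniusSeries_eq, ← mul_assoc, neg_mul_neg,
        ← PowerSeries.binomialSeries_add, neg_add_cancel, PowerSeries.binomialSeries_zero, one_mul]
      congr 1
      show _ = C ((W.frobeniusTrace (Rat.HeightOneSpectrum.primesEquiv v) : ℤ) : ℤ_[2]) - _ - _
      have : (Rat.HeightOneSpectrum.primesEquiv v : ℕ) = Rat.HeightOneSpectrum.natGenerator v := rfl
      rw [this]
      ring
    · -- multiplicative place: `𝒫_v ≡ a − (1+T)^{f_ℓ}`, `u_v = 1`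
      have hℓN : Rat.HeightOneSpectrum.natGenerator v ∣ N := hmultN hmul
      have huv_val : ((uv v : (IwasawaAlgebra 2)ˣ) : IwasawaAlgebra 2) = 1 := by
        rw [huv]; simp only [if_pos hℓN, Units.val_one]
      have ha1 : a (Rat.HeightOneSpectrum.natGenerator v) = 1 ∨ a (Rat.HeightOneSpectrum.natGenerator v) = -1 := by
        rw [hadef]
        simp only [if_pos hℓN, dif_pos (hprime v)]
        split_ifs
        · exact Or.inl rfl
        · exact Or.inr rfl
      rw [if_pos hℓN, sub_zero, huv_val, one_mul,
        map_toZMod_eulerFactorElement_two_eq_of_hasMultiplicativeReductionAt W v hmul (hcop v hv) ha1, frobeniusSeries_eq]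
  refine ⟨LW, _, ∏ v ∈ S₀, uv v, hLW, hG₁, ?_⟩
  rw [Finset.prod_image hinj, map_mul, map_prod, Finset.prod_congr rfl key, Units.coe_prod, eulerFactorProduct_eq,
    map_mul, map_mul, map_prod, map_prod]
  simp only [map_mul]
  rw [Finset.prod_mul_distrib]
  ring

/-! ### §3. The congruence for an even quadratic character at such a level -/

/-- **The `χ`-twisted tame `2`-adic `L`-function vs `L₂(E)·∏𝒫_v` modulo `2`, at a tame level whose places are good or
multiplicative** — the character half at a tame level meeting `N` (`exists_iwasawa_pair_map_toZMod_eq_two_sqfreeAt`: `N` is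
square-free at the primes of `m`, `ℓ_v ∥ N` at the multiplicative places) and the depletion half
(`exists_iwasawa_padicLFunctionTame_one_congr_two_sqfreeAt`) combined through the uniqueness of integral lifts: for `E = W/ℚ`
globally minimal, good ordinary at `2`, `f` its newform, `S₀` a finite set of odd places each of good or multiplicative reduction,
`m = ∏_{v∈S₀} ℓ_v`, and `χ` an EVEN QUADRATIC `ℚ₂`-valued character mod `m`: there are `L_W, G ∈ ℤ₂⟦T⟧`, `u ∈ ℤ₂⟦T⟧ˣ` with
`ι L_W = L₂(f,α)`, `ι G = L₂(f,α,χ)` and `G ≡ u·L_W·∏_{v∈S₀}𝒫_v (mod 2)`. The companion of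
`exists_iwasawa_padicLFunctionTame_congr_two_auto` (good places only). [cite: Matsuno2000, Lemmas 3.2–3.3 and proof of Theorem 3.1 (pp. 87–88)]
[cite: GreenbergVatsal2000, §2 Prop. (2.4)] -/
theorem exists_iwasawa_padicLFunctionTame_congr_two_sqfreeAt (hord : IsOrdinaryAt W 2) (hf : IsNewformOf W f)
    (S₀ : Finset (HeightOneSpectrum (𝓞 ℚ))) (hS2 : ∀ v ∈ S₀, Rat.HeightOneSpectrum.natGenerator v ≠ 2)
    (hred : ∀ v ∈ S₀, W.HasGoodReductionAt v ∨ W.HasMultiplicativeReductionAt v)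
    {m : ℕ} [NeZero m] (hm : m = ∏ v ∈ S₀, Rat.HeightOneSpectrum.natGenerator v)
    (χ : DirichletCharacter ℚ_[2] m) (hχ : χ.Even) (hsq : χ ^ 2 = 1) :
    ∃ (LW G : IwasawaAlgebra 2) (u : (IwasawaAlgebra 2)ˣ),
      iwasawaToPowerSeries 2 LW = padicLFunction f (unitRoot W 2 : ℚ_[2]) ∧
      iwasawaToPowerSeries 2 G = padicLFunctionTame f m (unitRoot W 2 : ℚ_[2]) χ ∧
      PowerSeries.map (PadicInt.toZMod (p := 2)) G =
        PowerSeries.map (PadicInt.toZMod (p := 2)) ((u : IwasawaAlgebra 2) * LW * eulerFactorProduct W 2 S₀) := by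
  have hprime : ∀ v : HeightOneSpectrum (𝓞 ℚ), (Rat.HeightOneSpectrum.natGenerator v).Prime := fun v ↦
    (Rat.HeightOneSpectrum.primesEquiv v).2
  have hm2 : m.Coprime 2 := by
    rw [hm]
    exact Nat.Coprime.prod_left fun v hv ↦ (Nat.coprime_primes (hprime v) Nat.prime_two).mpr (hS2 v hv)
  have hmN : ∀ ℓ : ℕ, ℓ.Prime → ℓ ∣ m → ¬ ℓ ^ 2 ∣ N := by
    intro ℓ hℓ hℓm
    rw [hm] at hℓm
    obtain ⟨v, hv, hℓv⟩ := (Prime.dvd_finsetProd_iff hℓ.prime _).mp hℓm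
    have hℓeq : ℓ = Rat.HeightOneSpectrum.natGenerator v := (Nat.prime_dvd_prime_iff_eq hℓ (hprime v)).mp hℓv
    rw [hℓeq]
    exact (not_sq_dvd_level_of_good_or_mult hf (hred v hv)).1
  obtain ⟨G, G₁, hG, hG₁, hGG₁⟩ := exists_iwasawa_pair_map_toZMod_eq_two_sqfreeAt hord hf hm2 hmN χ hχ hsq
  obtain ⟨LW, G₁', u, hLW, hG₁', hcongr⟩ :=
    exists_iwasawa_padicLFunctionTame_one_congr_two_sqfreeAt hord hf S₀ hS2 hred hm
  have hEq : G₁ = G₁' := iwasawaToPowerSeries_injective 2 (hG₁.trans hG₁'.symm)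
  exact ⟨LW, G, u, hLW, hG, by rw [hGG₁, hEq, hcongr]⟩

end DepletionAtTwo

end Literature.NumberTheory.EllipticCurves

end
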